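import Literature.Topology.FourManifolds.OneHandleStepContext
import Literature.Topology.FourManifolds.TwoDiscsDiffeotopy
import Literature.Topology.FourManifolds.OrientedConnectedSumExistence
import Literature.Topology.FourManifolds.SmoothEmbeddingComp
import Mathlib.Analysis.InnerProductSpace.Projection.FiniteDimensional
import HarnessLib

/-!
# The handle-extension step for one `1`-handle: correcting the seed and extending it

Topic `Literature/Topology/FourManifolds` (fact seat
`provefact-Literature.Topology.FourManifolds.IsHandlebody.exists_diffeomorph_isBoundaryGluing_sphere`,
step F2b₁ of the Lickorish–Wallace DAG; assembly of the level step H of the reduction of L1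
`oneHandle_nonempty_diffeomorph`, continued from `OneHandleStepContext.lean`).  Everything here
is **proved**; no named facts.

Given a context `C : OneHandleStepContext n M M'` whose `+` discs match (`C.Match`):

1. **The two-disc theorem in the seed level of `M'`** (`TwoDiscsDiffeotopy.lean`; Hirsch 1976,
   Ch. 8 §3): the four discs — `C.disc (±1)` from `M`, `C.disc' (±1)` from `M'`, the `-` discs
   reparametrised by a hyperplane reflection of `ℝⁿ` so that all four have the same character
   (opposite characters of the two feet, `OneHandleStepContext.disc_oppositeCharacters`) — are
   matched on the unit balls by a diffeomorphism `f₂` compactly diffeotopic to the identity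
   (`exists_diffeotopy_discs`).
2. **The corrected seed** `g₁ = κ ∘ g₀`, `κ` the suspension of that diffeotopy along the flow of
   `M'` (`LevelDiffeotopySuspension.lean`), is again a lower pair
   (`LowerPairCorrection.lean`) and carries the flowed-down feet of `M` onto those of `M'`
   (`exists_corrected_seed`).
3. **Extension up the slab** (`LevelFlowExtension.lean`, `IsLowerPair.exists_extend`) to the
   level `a + 2η₀` with a width `η₀ ∈ (η/2, 2η/3]`, the extension being the flow conjugate of
   the corrected seed, hence **equal to the chart map on the feet** at the level `a`
   (`exists_extended_pair`).

The assembly into a `HandlePair` and the diffeomorphism `M ≅ M'` follow in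
`OneHandleStepPair.lean`.

## References

* J. Milnor, *Lectures on the h-cobordism theorem* (1965), proof of Thm. 3.13 (PDF pp. 18–19).
  [MilnorHCobordism1965]
* M. W. Hirsch, *Differential Topology*, GTM 33 (1976), Ch. 8 §3, Thms. 3.1–3.2. [HirschDT1976]
* A. A. Kosinski, *Differential Manifolds* (1993), VI (6.6). [Kosinski1993]
-/

open scoped Manifold ContDiff Topology
open Set Function Filter Metric Module

noncomputable section

namespace Literature.Topology.FourManifolds

universe u

/-- Local notation: `𝔼 n` is the model Euclidean space `EuclideanSpace ℝ (Fin n)`. -/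
local notation "𝔼 " n:arg => EuclideanSpace ℝ (Fin n)

/-! ### A hyperplane reflection of the model space -/

section Reflection

variable {n : ℕ} (hn : 1 ≤ n)

/-- A unit coordinate vector of `ℝⁿ`, `n ≥ 1`. [folklore] -/
def stepUnitVec (hn : 1 ≤ n) : 𝔼 n := EuclideanSpace.single ⟨0, hn⟩ 1

/-- The unit coordinate vector is nonzero. [folklore] -/
theorem stepUnitVec_ne_zero : stepUnitVec hn ≠ 0 := by
  intro h
  have := congrArg (fun v : 𝔼 n => v ⟨0, hn⟩) h
  simp [stepUnitVec] at this

/-- **The reflection of `ℝⁿ` in the hyperplane orthogonal to a coordinate vector.** [folklore] -/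
def modelReflection : 𝔼 n ≃ₗᵢ[ℝ] 𝔼 n := ((ℝ ∙ stepUnitVec hn)ᗮ).reflection

/-- The reflection has determinant `-1`. [folklore] -/
theorem det_modelReflection : LinearMap.det ((modelReflection hn).toLinearEquiv : 𝔼 n →ₗ[ℝ] 𝔼 n) = -1 := by
  have h := Submodule.det_reflection (K := (ℝ ∙ stepUnitVec hn)ᗮ)
  rw [Submodule.orthogonal_orthogonal, finrank_span_singleton (stepUnitVec_ne_zero hn), pow_one] at h
  unfold modelReflection
  exact h

/-- The reflection has negative determinant. [folklore] -/
theorem det_modelReflection_neg : LinearMap.det ((modelReflection hn).toLinearEquiv : 𝔼 n →ₗ[ℝ] 𝔼 n) < 0 := by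
  rw [det_modelReflection]; norm_num

/-- The reflection is an involution. [folklore] -/
@[simp] theorem modelReflection_modelReflection (w : 𝔼 n) : modelReflection hn (modelReflection hn w) = w :=
  Submodule.reflection_reflection _ w

/-- The reflection preserves the norm. [folklore] -/
@[simp] theorem norm_modelReflection (w : 𝔼 n) : ‖modelReflection hn w‖ = ‖w‖ := (modelReflection hn).norm_map w

end Reflection

namespace OneHandleStepContext

variable {n : ℕ} {M : Type u} [TopologicalSpace M] [ChartedSpace (EuclideanHalfSpace (n + 1)) M]
  [IsManifold (𝓡∂ (n + 1)) ∞ M]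
  {M' : Type u} [TopologicalSpace M'] [ChartedSpace (EuclideanHalfSpace (n + 1)) M'] [IsManifold (𝓡∂ (n + 1)) ∞ M']
  [T2Space M'] (C : OneHandleStepContext n M M')

/-! ### Characters: all four discs made equally oriented -/

/-- **A disc reversing the orientations preserves them after the reflection of `ℝⁿ`.**
[folklore] -/
theorem isOrientationPreserving_comp_modelReflection {V : Type*} [TopologicalSpace V] [ChartedSpace (𝔼 n) V]
    [IsManifold (𝓡 n) ∞ V] (hn : 1 ≤ n) {i : 𝔼 n → V} (hi : Manifold.IsSmoothEmbedding 𝓘(ℝ, 𝔼 n) (𝓡 n) ∞ i)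
    (ho : IsOpen (range i)) {o₀ : Orientation ℝ (𝔼 n) (Fin (finrank ℝ (𝔼 n)))} {oV : SmoothOrientation (𝓡 n) V}
    (h : IsOrientationPreserving (SmoothOrientation.modelSpace (-o₀)) oV i) :
    IsOrientationPreserving (SmoothOrientation.modelSpace o₀) oV (i ∘ modelReflection hn) := by
  -- `i` preserves `(o₀, -oV)`, so `i ∘ R` reverses `(o₀, -oV)`, i.e. preserves `(o₀, oV)`
  have h' : IsOrientationPreserving (SmoothOrientation.modelSpace o₀) (-oV) i := by
    rw [← isOrientationPreserving_neg_neg_iff, SmoothOrientation.neg_modelSpace, neg_neg]; exact h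
  have := isOrientationReversing_disc_comp hi ho h' (modelReflection hn) (det_modelReflection_neg hn)
  rw [isOrientationReversing_iff_neg, isOrientationPreserving_neg_neg_iff] at this
  exact this

omit [T2Space M'] in
/-- **A common model orientation for the four discs**: there is `o₀` for which `disc 1`,
`disc' 1`, `disc (-1) ∘ R`, `disc' (-1) ∘ R` all preserve `(o₀, oV')`. [cite: Kosinski1993, VI (6.6)] -/
theorem exists_common_orientation (hM : C.Match) :
    ∃ o₀ : Orientation ℝ (𝔼 n) (Fin (finrank ℝ (𝔼 n))),
      IsOrientationPreserving (SmoothOrientation.modelSpace o₀) C.oV' (C.disc (one_pow 2)) ∧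
      IsOrientationPreserving (SmoothOrientation.modelSpace o₀) C.oV' (C.disc' (one_pow 2)) ∧
      IsOrientationPreserving (SmoothOrientation.modelSpace o₀) C.oV' (C.disc neg_one_sq ∘ modelReflection C.hn1) ∧
      IsOrientationPreserving (SmoothOrientation.modelSpace o₀) C.oV' (C.disc' neg_one_sq ∘ modelReflection C.hn1) := by
  -- a model orientation with `disc 1` preserving
  obtain ⟨o₀, h₁⟩ : ∃ o₀ : Orientation ℝ (𝔼 n) (Fin (finrank ℝ (𝔼 n))),
      IsOrientationPreserving (SmoothOrientation.modelSpace o₀) C.oV' (C.disc (one_pow 2)) := by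
    set oref : Orientation ℝ (𝔼 n) (Fin (finrank ℝ (𝔼 n))) := (stdOrthonormalBasis ℝ (𝔼 n)).toBasis.orientation
    rcases isOrientationPreserving_or_isOrientationReversing_disc (C.isSmoothEmbedding_disc (one_pow 2))
      (C.isOpen_range_disc (one_pow 2)) oref C.oV' with h | h
    · exact ⟨oref, h⟩
    · refine ⟨-oref, ?_⟩
      rw [isOrientationReversing_iff_neg, SmoothOrientation.neg_modelSpace] at h; exact h
  have h₁' := (hM.iff o₀).1 h₁
  have h₂ : IsOrientationPreserving (SmoothOrientation.modelSpace (-o₀)) C.oV' (C.disc neg_one_sq) :=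
    (C.disc_oppositeCharacters C.oV' o₀).1 h₁
  have h₂' : IsOrientationPreserving (SmoothOrientation.modelSpace (-o₀)) C.oV' (C.disc' neg_one_sq) :=
    (C.disc'_oppositeCharacters C.oV' o₀).1 h₁'
  exact ⟨o₀, h₁, h₁', isOrientationPreserving_comp_modelReflection C.hn1 (C.isSmoothEmbedding_disc neg_one_sq)
    (C.isOpen_range_disc neg_one_sq) h₂, isOrientationPreserving_comp_modelReflection C.hn1
    (C.isSmoothEmbedding_disc' neg_one_sq) (C.isOpen_range_disc' neg_one_sq) h₂'⟩

/-! ### The two-disc theorem in the seed level -/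

/-- **The diffeotopy of the seed level of `M'` carrying the discs of `M` onto those of `M'`** on
the unit balls. [cite: HirschDT1976, Ch. 8 §3, Thms. 3.1–3.2] -/
theorem exists_diffeotopy_discs (hM : C.Match) :
    ∃ D₂ : Diffeotopy (𝓡 n) (C.Sl'.Level (C.c + C.σ)),
      (∀ w : 𝔼 n, ‖w‖ ≤ 1 → D₂.toFun 1 (C.disc (one_pow 2) w) = C.disc' (one_pow 2) w) ∧
      ∀ w : 𝔼 n, ‖w‖ ≤ 1 → D₂.toFun 1 (C.disc neg_one_sq w) = C.disc' neg_one_sq w := by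
  obtain ⟨o₀, h₁, h₁', h₂, h₂'⟩ := C.exists_common_orientation hM
  have hR' : ∀ {i : 𝔼 n → C.Sl'.Level (C.c + C.σ)},
      Manifold.IsSmoothEmbedding 𝓘(ℝ, 𝔼 n) (𝓡 n) ∞ i →
        Manifold.IsSmoothEmbedding 𝓘(ℝ, 𝔼 n) (𝓡 n) ∞ (i ∘ modelReflection C.hn1) := fun hi =>
    hi.comp_openPartialHomeomorph (modelReflection C.hn1).toContinuousLinearEquiv.toHomeomorph.toOpenPartialHomeomorph
      (by simp) (modelReflection C.hn1).toContinuousLinearEquiv.contDiff.contMDiff.contMDiffOn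
      (modelReflection C.hn1).symm.toContinuousLinearEquiv.contDiff.contMDiff.contMDiffOn
  obtain ⟨f₂, hf₂, hP, hMm⟩ := exists_isCompactlyDiffeotopicToIdIn_apply_two_discs_eq C.hn
    (C.isSmoothEmbedding_disc (one_pow 2)) (hR' (C.isSmoothEmbedding_disc neg_one_sq))
    (C.isSmoothEmbedding_disc' (one_pow 2)) (hR' (C.isSmoothEmbedding_disc' neg_one_sq))
    h₁ h₂ h₁' h₂' (by rw [(modelReflection C.hn1).surjective.range_comp]; exact C.disjoint_range_disc)
    (by rw [(modelReflection C.hn1).surjective.range_comp]; exact C.disjoint_range_disc')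
    isOpen_univ C.isPreconnected_univ_levelC' (subset_univ _) (subset_univ _) (subset_univ _) (subset_univ _)
  obtain ⟨D₂, K, -, -, hD₂, -⟩ := hf₂
  refine ⟨D₂, fun w hw => ?_, fun w hw => ?_⟩
  · rw [← Diffeotopy.coe_stage, hD₂]; exact hP w hw
  · rw [← Diffeotopy.coe_stage, hD₂]
    have h := hMm (modelReflection C.hn1 w) (by rw [norm_modelReflection]; exact hw)
    simp only [comp_apply, modelReflection_modelReflection] at h
    exact h

/-! ### The corrected seed -/

omit [T2Space M'] in
/-- Room for the suspension below the seed level of `M'`. [folklore] -/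
theorem lo'_le : C.Sl'.lo ≤ C.c + C.σ - 3 * C.τ := by
  show C.S'.ℓ₁ ≤ _; rw [C.hℓ₁, C.hℓ₁_eq]; linarith [C.τ_pos]

omit [T2Space M'] in
/-- Room for the suspension above the seed level of `M'`. [folklore] -/
theorem le_hi' : C.c + C.σ + 4 * C.τ ≤ C.Sl'.hi := by
  show _ ≤ C.S'.a + 2 * C.S'.η; rw [C.ha, C.hη]; linarith [C.c_le, C.τ_pos, sq_nonneg C.S.ε, C.η_pos]

/-- **The corrected seed**: a lower pair at the seed level carrying the flowed-down feet of `M`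
onto those of `M'` (on the closed unit parameter balls). [cite: MilnorHCobordism1965, proof of Thm. 3.13 (PDF pp. 18–19)] -/
theorem exists_corrected_seed (hM : C.Match) :
    ∃ (g₁ : M → M') (g₁' : M' → M), IsLowerPair C.Sl C.Sl' C.σ (C.c + C.τ) (C.τ / 3) g₁ g₁' ∧
      ∀ {s : ℝ} (hs : s ^ 2 = 1) (w : 𝔼 n), ‖w‖ ≤ 1 → (s = 1 ∨ s = -1) →
        g₁ (C.Sl.levelIncl (C.Λ (C.T.footLift C.ρ_pos C.hmR hs w))) =
          C.Sl'.levelIncl (C.Λ' (C.T'.footLift C.ρ_pos C.hmR' hs w)) := by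
  obtain ⟨D₂, hP, hMm⟩ := C.exists_diffeotopy_discs hM
  set κ := C.Sl'.suspDiffeomorph (c := C.c + C.σ) C.τ_pos C.lo'_le C.le_hi' rfl C.hn1 D₂ with hκ
  refine ⟨κ ∘ C.g₀, C.g₀' ∘ κ.symm, ?_, ?_⟩
  · refine C.seed.postcomp (by linarith [C.τ_pos]) κ
      (fun y => C.Sl'.apply_suspDiffeomorph C.τ_pos C.lo'_le C.le_hi' rfl C.hn1 D₂ y) fun y t hy ht => ?_
    have hτ := C.τ_pos
    exact C.Sl'.suspDiffeomorph_flow_of_mem C.τ_pos C.lo'_le C.le_hi' rfl C.hn1 D₂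
      ⟨by linarith [hy.1], by linarith [hy.2]⟩ ⟨by linarith [ht.1], by linarith [ht.2]⟩
  · intro s hs w hw hs1
    have h2 : ∀ z : C.Sl'.Level (C.c + C.σ), κ (C.Sl'.levelIncl z) = C.Sl'.levelIncl (D₂.toFun 1 z) := fun z => by
      have := C.Sl'.suspDiffeomorph_flow C.τ_pos C.lo'_le C.le_hi' rfl C.hn1 D₂ z (t := 0)
        ⟨by linarith [C.τ_pos], by linarith [C.τ_pos]⟩
      rwa [C.Sl'.isFlowOf.map_zero, C.Sl'.isFlowOf.map_zero] at this
    show κ (C.g₀ (C.Sl.levelIncl (C.Λ (C.T.footLift C.ρ_pos C.hmR hs w)))) = _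
    have h1 : C.g₀ (C.Sl.levelIncl (C.Λ (C.T.footLift C.ρ_pos C.hmR hs w))) =
        C.Sl'.levelIncl (C.Ψlev (C.Λ (C.T.footLift C.ρ_pos C.hmR hs w))) := rfl
    rw [h1, h2]
    rcases hs1 with rfl | rfl
    · exact congrArg C.Sl'.levelIncl (hP w hw)
    · exact congrArg C.Sl'.levelIncl (hMm w hw)

/-! ### The extension up the slab -/

/-- **The extended pair**: a lower pair at the level `a + 2η₀`, of a width `η₀ ∈ (η/2, 2η/3]`,
equal to the chart map on the feet of `M` at the level `a` (on the closed unit parameter balls).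
[cite: MilnorHCobordism1965, proof of Thm. 3.13 (PDF pp. 18–19)] -/
theorem exists_extended_pair (hM : C.Match) :
    ∃ (g : M → M') (g' : M' → M) (η₀ : ℝ) (N : ℕ), C.S.η / 2 < η₀ ∧ η₀ ≤ 2 * C.S.η / 3 ∧
      C.c + C.τ + N * η₀ = C.S.a + 2 * η₀ ∧
      IsLowerPair C.Sl C.Sl' C.σ (C.c + C.τ + N * η₀) η₀ g g' ∧
      ∀ {s : ℝ} (hs : s ^ 2 = 1) (w : 𝔼 n), ‖w‖ ≤ 1 → (s = 1 ∨ s = -1) →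
        g (C.S.D.foot s C.m C.ρ w) = C.S'.D.foot s C.m' C.ρ w := by
  obtain ⟨g₁, g₁', hP₁, hfeet₁⟩ := C.exists_corrected_seed hM
  have hτ := C.τ_pos; have hη := C.η_pos
  -- the arithmetic of the steps
  set L : ℝ := C.S.a - C.c - C.τ with hL
  have hLτ : 7 * C.τ + 24 * C.S.ε ^ 2 ≤ L := by rw [hL]; linarith [C.c_le]
  have hLpos : 0 < L := by linarith [sq_nonneg C.S.ε]
  have hLη : 2 * C.S.η ≤ L := by linarith [C.hητ, sq_nonneg C.S.ε]
  set q : ℝ := 3 * L / (2 * C.S.η) with hq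
  have hqpos : 0 < q := by rw [hq]; positivity
  set N' : ℕ := ⌈q⌉₊ with hN'
  have hN'q : q ≤ N' := Nat.le_ceil q
  have hN'lt : (N' : ℝ) < q + 1 := Nat.ceil_lt_add_one hqpos.le
  have hN'pos : (0 : ℝ) < N' := lt_of_lt_of_le hqpos hN'q
  set η₀ : ℝ := L / N' with hη₀
  have hη₀pos : 0 < η₀ := div_pos hLpos hN'pos
  have hη₀le : η₀ ≤ 2 * C.S.η / 3 := by
    rw [hη₀, div_le_iff₀ hN'pos]
    have : 3 * L / (2 * C.S.η) * (2 * C.S.η / 3) = L := by field_simp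
    nlinarith
  have hη₀gt : C.S.η / 2 < η₀ := by
    rw [hη₀, lt_div_iff₀ hN'pos]
    have : (q + 1) * (C.S.η / 2) ≤ L := by
      rw [hq]
      have : 3 * L / (2 * C.S.η) * (C.S.η / 2) = 3 * L / 4 := by field_simp; ring
      nlinarith
    nlinarith
  set N : ℕ := N' + 2 with hN
  have hNη₀ : (N : ℝ) * η₀ = L + 2 * η₀ := by
    rw [hN]; push_cast
    have : (N' : ℝ) * η₀ = L := by rw [hη₀]; field_simp
    linarith [this]
  have hA : C.c + C.τ + N * η₀ = C.S.a + 2 * η₀ := by rw [hNη₀, hL]; ring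
  -- the extension
  have hlo : C.Sl.lo ≤ C.c - C.τ := by show C.S.ℓ₁ ≤ _; rw [C.hℓ₁_eq]; linarith
  have hlo' : C.Sl'.lo ≤ C.c + C.σ - C.τ := by show C.S'.ℓ₁ ≤ _; rw [C.hℓ₁, C.hℓ₁_eq]; linarith
  have hhi : C.c + C.τ + C.τ / 3 ≤ C.Sl.hi := by
    show _ ≤ C.S.a + 2 * C.S.η; linarith [C.c_le, sq_nonneg C.S.ε]
  have hhi' : C.c + C.σ + C.τ + C.τ / 3 ≤ C.Sl'.hi := by
    show _ ≤ C.S'.a + 2 * C.S'.η; rw [C.ha, C.hη]; linarith [C.c_le, sq_nonneg C.S.ε]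
  have hη₀τ : 18 * η₀ ≤ 5 * C.τ := by linarith [C.hητ]
  have hNhi : C.c + C.τ + N * η₀ ≤ C.Sl.hi := by show _ ≤ C.S.a + 2 * C.S.η; rw [hA]; linarith
  have hNhi' : C.c + C.σ + C.τ + N * η₀ ≤ C.Sl'.hi := by
    show _ ≤ C.S'.a + 2 * C.S'.η; rw [C.ha, C.hη]; linarith [hA]
  obtain ⟨g, g', hP, -, -, hconj⟩ := IsLowerPair.exists_extend hτ hP₁ hlo hlo' hhi hhi' hη₀pos hη₀τ N hNhi hNhi'
  refine ⟨g, g', η₀, N, hη₀gt, hη₀le, hA, hP, fun {s} hs w hw hs1 => ?_⟩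
  -- the feet
  have hfv : C.S.f (C.S.D.foot s C.m C.ρ w) = C.S.f C.S.p - C.m := C.T.apply_foot C.ρ_pos C.hmR hs w
  have h1 := hconj (C.S.D.foot s C.m C.ρ w) (by show C.c ≤ C.S.f _; rw [hfv, C.fp_sub_m]; linarith [C.c_le, sq_nonneg C.S.ε])
    (by show C.S.f _ < _; rw [hfv, C.fp_sub_m, hA]; linarith)
  rw [show C.Sl.f (C.S.D.foot s C.m C.ρ w) = C.S.f C.S.p - C.m from hfv] at h1
  rw [h1]
  -- `θ (c - (f p - m), foot) = ι (Λ (footLift w))`, then the corrected seed, then back up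
  have h2 : C.Sl.θ (C.c - (C.S.f C.S.p - C.m), C.S.D.foot s C.m C.ρ w) =
      C.Sl.levelIncl (C.Λ (C.T.footLift C.ρ_pos C.hmR hs w)) := rfl
  rw [h2, hfeet₁ hs w hw hs1]
  show C.S'.θ (C.S.f C.S.p - C.m - C.c, C.S'.θ (C.c + C.σ - (C.S'.f C.S'.p - C.m'), C.S'.D.foot s C.m' C.ρ w)) = _
  rw [C.S'.isFlowOf.map_add, C.fp_sub_m, C.fp_sub_m', C.ha, show C.S.a - C.c + (C.c + C.σ - (C.S.a + C.σ)) = 0 by ring,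
    C.S'.isFlowOf.map_zero]

end OneHandleStepContext

end Literature.Topology.FourManifolds
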